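import Summits.QuantumFields.BalabanUV.T4Continuum.Spine.NE1p.DressedSizeDomination
import Literature.MathematicalPhysics.QuantumFieldTheory.Balaban1983to89.T4DressedR

/-!
# T⁴ programme, spine estimate NE1′ — the size half's value maps INSTANTIATED on the tree's model of the basic ℝ-step
# ([Balaban1989LargeFieldI] (0.3) p. 176 as `B15.BasicStep.Rop03`; convention (α) as `T4DressedR.RopIn`)

Cell `pub-balaban-gaps`, seat `ne1`, record `HOME/ne/NE1.md` §6; ADDITIVE — imports `Spine/NE1p/DressedSizeDomination` and
`T4DressedR` only, modifies nothing.

WHAT THIS IS.  `DressedSizeDomination` §1 READS every value map of Bałaban's run as monotone positively-homogeneous and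
proves domination along any chain of such maps ABSTRACTLY.  Here the reading is made a THEOREM for the one step the tree
models concretely: the fibre integral `∫⋯∫⁻_s, · ∂μ` (= the paper's `∫dV⌈_{Z′}`, Mathlib `lmarginal`) is an `IsPosHom`
(`isPosHom_lmarginal`, no measurability needed); the `Z`-term of `Rop03 μ piece pp fib` IS `ratioOp` of the insert
`piece (pp Z)`, its normalisation and the fibre integral, applied to the integrated piece (`rop03Term_eq_ratioOp`); hence
(`rop03Term_dominated`, `dominated_rop03_ropIn`) a dressing `w` with `m ≤ w ≤ M` gives
`m·ℝ(ρ) ≤ ℝ_in(ρ·w) ≤ M·ℝ(ρ)` TERMWISE and summed — `T4DressedR.mul_le_ropIn` ∕ `ropIn_le_mul` at constant bounds recovered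
as the `n = 1` case of `DressedSizeDomination.dominated_run`, and chainable: the OUTPUT domination is again an input of
`IsPosHom.dominated` for the next step (`dominated_rop03_step`), which the one-step sandwich of `T4DressedR` is not
phrased to do (its dressing is an outside factor `w`, here it is any dominated family of integrated pieces).

WHAT THIS IS NOT.  Not NE1′; nothing instantiated on Bałaban's densities (`piece`, `pp`, `fib` are the reader's data exactly
as in `B15.BasicStep`); the renormalisation transformation `T` is covered abstractly by `DressedSizeDomination.kernelOp`
(any positive kernel), not by a constructed averaging.  Rung (B)+1 bookkeeping on one finite four-torus — NOT infinite
volume, NOT a mass gap, NOT Clay; spine PROVED 0∕9.  Every declaration is [folklore]; (0.3) is cited for its SHAPE only.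
-/

noncomputable section

namespace Summit.QuantumFields.BalabanUV.T4Continuum.NE1p.DressedSizeDomination

open MeasureTheory Finset
open scoped ENNReal BigOperators
open Literature.MathematicalPhysics.QuantumFieldTheory.Balaban1983to89
open Literature.MathematicalPhysics.QuantumFieldTheory.Balaban1983to89.B15.BasicStep
open Literature.MathematicalPhysics.QuantumFieldTheory.Balaban1983to89.T4DressedR

section Fibre

variable {ι : Type*} [DecidableEq ι] {X : ι → Type*} [∀ i, MeasurableSpace (X i)] (μ : ∀ i, Measure (X i))

/-- THE FIBRE INTEGRAL `f ↦ ∫⋯∫⁻_s, f ∂μ` (the paper's `∫dV⌈_{Z′}`) is monotone positively-homogeneous — by the definition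
of `lmarginal` as a `lintegral` over the fibre; no measurability hypothesis. [folklore] -/
theorem isPosHom_lmarginal (s : Finset ι) : IsPosHom (fun f : (∀ i, X i) → ℝ≥0∞ => ∫⋯∫⁻_s, f ∂μ) where
  mono := fun _ _ h => lmarginal_mono h
  smul := fun c hc f => funext fun x => by
    simp only [lmarginal, Pi.smul_apply, smul_eq_mul]
    exact lintegral_const_mul' c _ hc

/-- The `Z`-term of (0.3) with the integrated piece as the variable: insert `piece (pp Z)`, normalisation
`∫⋯∫⁻_(fib Z), piece (pp Z)`, fibre integral of the argument. [folklore] -/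
def rop03Term {R : Type*} (piece : R → (∀ i, X i) → ℝ≥0∞) (pp : R → R) (fib : R → Finset ι) (Z : R)
    (f : (∀ i, X i) → ℝ≥0∞) : (∀ i, X i) → ℝ≥0∞ :=
  fun V => piece (pp Z) V * ((∫⋯∫⁻_(fib Z), f ∂μ) V / (∫⋯∫⁻_(fib Z), piece (pp Z) ∂μ) V)

/-- **THE `Z`-TERM OF (0.3) IS A `ratioOp`** (undressed insert and normalisation, fibre integral as the inner map).
[folklore] -/
theorem rop03Term_eq_ratioOp {R : Type*} (piece : R → (∀ i, X i) → ℝ≥0∞) (pp : R → R) (fib : R → Finset ι)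
    (Z : R) :
    rop03Term μ piece pp fib Z =
      ratioOp (piece (pp Z)) (∫⋯∫⁻_(fib Z), piece (pp Z) ∂μ) (fun f => ∫⋯∫⁻_(fib Z), f ∂μ) := by
  funext f V
  simp only [rop03Term, ratioOp, mul_div_assoc]

/-- Hence the `Z`-term is monotone positively-homogeneous in the integrated piece. [folklore] -/
theorem isPosHom_rop03Term {R : Type*} (piece : R → (∀ i, X i) → ℝ≥0∞) (pp : R → R) (fib : R → Finset ι)
    (Z : R) : IsPosHom (rop03Term μ piece pp fib Z) := by
  rw [rop03Term_eq_ratioOp]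
  exact isPosHom_ratioOp _ _ (isPosHom_lmarginal μ (fib Z))

/-- (0.3) undressed is the sum of the `Z`-terms at the undressed pieces; convention (α) dressed is the sum at the dressed
pieces `piece Z * w` (both definitional). [folklore] -/
theorem rop03_eq_sum_rop03Term {R : Type*} [Fintype R] (piece : R → (∀ i, X i) → ℝ≥0∞) (pp : R → R)
    (fib : R → Finset ι) (V : ∀ i, X i) :
    Rop03 μ piece pp fib V = ∑ Z, rop03Term μ piece pp fib Z (piece Z) V := rfl

/-- Convention (α) dressed = the sum of the `Z`-terms at the dressed pieces `piece Z * w` (definitional). [folklore] -/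
theorem ropIn_eq_sum_rop03Term {R : Type*} [Fintype R] (piece : R → (∀ i, X i) → ℝ≥0∞) (pp : R → R)
    (fib : R → Finset ι) (w : (∀ i, X i) → ℝ≥0∞) (V : ∀ i, X i) :
    RopIn μ piece pp fib w V = ∑ Z, rop03Term μ piece pp fib Z (piece Z * w) V := rfl

/-- **TERMWISE, CHAINABLE**: ANY domination `m·f₀ ≤ f ≤ M·f₀` of the integrated piece (not only `f = f₀·w`) passes to the
`Z`-term of (0.3) with the same constants. [folklore] -/
theorem rop03Term_dominated {R : Type*} (piece : R → (∀ i, X i) → ℝ≥0∞) (pp : R → R) (fib : R → Finset ι) (Z : R)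
    {m M : ℝ≥0∞} (hm : m ≠ ∞) (hM : M ≠ ∞) {f₀ f : (∀ i, X i) → ℝ≥0∞} (h : Dominated m M f₀ f) :
    Dominated m M (rop03Term μ piece pp fib Z f₀) (rop03Term μ piece pp fib Z f) :=
  (isPosHom_rop03Term μ piece pp fib Z).dominated hm hM h

/-- Finite sums of dominated families are dominated (same constants). [folklore] -/
theorem Dominated.sum {Y : Type*} {R : Type*} (S : Finset R) {m M : ℝ≥0∞} {f₀ f : R → Y → ℝ≥0∞}
    (h : ∀ Z ∈ S, Dominated m M (f₀ Z) (f Z)) :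
    Dominated m M (fun y => ∑ Z ∈ S, f₀ Z y) (fun y => ∑ Z ∈ S, f Z y) := by
  refine ⟨fun y => ?_, fun y => ?_⟩
  · show m * ∑ Z ∈ S, f₀ Z y ≤ ∑ Z ∈ S, f Z y
    rw [Finset.mul_sum]
    exact Finset.sum_le_sum fun Z hZ => by simpa only [Pi.smul_apply, smul_eq_mul] using (h Z hZ).1 y
  · show ∑ Z ∈ S, f Z y ≤ M * ∑ Z ∈ S, f₀ Z y
    rw [Finset.mul_sum]
    exact Finset.sum_le_sum fun Z hZ => by simpa only [Pi.smul_apply, smul_eq_mul] using (h Z hZ).2 y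

/-- **ONE BASIC ℝ-STEP, CONSTANT BOUNDS, AS AN INSTANCE OF §1**: a dressing with `m ≤ w ≤ M` gives
`m·ℝ(ρ) ≤ ℝ_in(ρ·w) ≤ M·ℝ(ρ)` pointwise (`T4DressedR.mul_le_ropIn` ∕ `ropIn_le_mul` at constant `m`, `M`, re-derived from
`dominated_mul_of_bounds` + `rop03Term_dominated`; no measurability or independence hypothesis). [folklore] -/
theorem dominated_rop03_ropIn {R : Type*} [Fintype R] (piece : R → (∀ i, X i) → ℝ≥0∞) (pp : R → R)
    (fib : R → Finset ι) {w : (∀ i, X i) → ℝ≥0∞} {m M : ℝ≥0∞} (hm : m ≠ ∞) (hM : M ≠ ∞) (hlo : ∀ V, m ≤ w V)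
    (hhi : ∀ V, w V ≤ M) : Dominated m M (Rop03 μ piece pp fib) (RopIn μ piece pp fib w) := by
  have h := Dominated.sum (Finset.univ : Finset R)
    (f₀ := fun Z => rop03Term μ piece pp fib Z (piece Z)) (f := fun Z => rop03Term μ piece pp fib Z (piece Z * w))
    fun Z _ => rop03Term_dominated μ piece pp fib Z hm hM (dominated_mul_of_bounds hlo hhi)
  exact h

/-- **THE STEP IS CHAINABLE**: if the integrated pieces of the dressed run are ALREADY dominated termwise by the undressed
pieces (the output of earlier steps, not of the form `piece·w`), the (α)-ℝ-step's outputs are dominated with the same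
constants — the induction step of `DressedSizeDomination.dominated_iter` on the tree's model of (0.3). [folklore] -/
theorem dominated_rop03_step {R : Type*} [Fintype R] (piece dressed : R → (∀ i, X i) → ℝ≥0∞) (pp : R → R)
    (fib : R → Finset ι) {m M : ℝ≥0∞} (hm : m ≠ ∞) (hM : M ≠ ∞) (h : ∀ Z, Dominated m M (piece Z) (dressed Z)) :
    Dominated m M (Rop03 μ piece pp fib) (fun V => ∑ Z, rop03Term μ piece pp fib Z (dressed Z) V) :=
  Dominated.sum (Finset.univ : Finset R) fun Z _ => rop03Term_dominated μ piece pp fib Z hm hM (h Z)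

end Fibre

end Summit.QuantumFields.BalabanUV.T4Continuum.NE1p.DressedSizeDomination

end
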